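import Mathlib
import Summits.Schanuel.Schanuel.Theses.RigidCore
import Summits.Schanuel.Schanuel.Theorems.AclSubsetLogFreeCore.Negative.ExpAclField
import Summits.Schanuel.Schanuel.Theorems.RoyCriterionRankOne
import Literature.NumberTheory.Transcendental.LindemannWeierstrassProofs
import Summits.Schanuel.Schanuel.Theorems.RigidCoreMinimalCounterexampleInAclLinearIndependentDefinable
import Summits.Schanuel.Schanuel.Theorems.RigidCoreMinimalCounterexampleInAclLocusDefinable
import Summits.Schanuel.Schanuel.Theorems.RigidCoreMinimalCounterexampleInAclMateFirstFailure
import Summits.Schanuel.Schanuel.Theorems.RigidCoreMinimalCounterexampleInAclEndgame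
import Summits.Schanuel.Schanuel.Theorems.RigidCoreMinimalCounterexampleInAclSweepToSubspaceOfLine
import Summits.Schanuel.Schanuel.Theorems.RigidCoreMinimalCounterexampleInAclSweepLineAlgPeriod
import Summits.Schanuel.Schanuel.Theorems.RigidCoreMinimalCounterexampleInAclSweepLineHardCore
import Summits.Schanuel.Schanuel.Theorems.RigidCoreMinimalCounterexampleInAclBranchFinitenessRankTwo

/-!
# (S*) ON THE LOG SECTOR — a first-failure counterexample to Schanuel among logarithms of algebraic numbers lies in `acl^{ℂ_exp}(∅)`

Crux stmt-Schanuel-0969 `RigidCore.MinimalCounterexampleInAcl`, line `kernel-arithmetic-selection` (lead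
prover-line-stmt-Schanuel-0969-0): this file proves the registered stub `stub_cruxLogSector` — the crux (S*) restricted to
first failures `x` ALL of whose exponentials `e^{x_i}` are algebraic — UNCONDITIONALLY, at every rank, by assembling the
landed stubs of the line:

* VOCABULARY `locusPts x` (tuples satisfying every ℚ-polynomial relation of `(x, eˣ)`), `locusMates x` (the ℚ-linearly
  independent ones), `firstFailures n` (the crux's hypothesis bundle as a set), `kerTranslate x k = x + 2πik`;
* FINITELY MANY CLASSES: on the log sector the exponentials of mates are coordinatewise conjugates of `eˣ`
  (`expImage_finite_of_algebraic`);
* EACH CLASS FINITE (branch finiteness, all ranks): rank 2 = `stub_branchFiniteness_rankTwo` (Baker-free: moving sector /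
  HL / dilation structure of plane curves); ranks ≥ 3 = the sweep `stub_sweepToSubspace_of_line` (Case A + collinear case +
  line ⟹ subspace) fed by `stub_sweepLine_algPeriod` (2πi algebraic over ℚ(eˣ): minimal primes + shear) and
  `stub_sweepLine_hardCore` (iterated-resultant walk), closed by `stub_endgame` (a rational affine subspace through a first
  failure inside its own fibre is a smaller Schanuel counterexample — where `SC(<n)` is spent) at the surviving
  mate-translate, which is a first failure with the same locus by `stub_mateFirstFailure`;
* FINITE MATE SET (`locusMates_finite`: kernel fibres over the finite exponential image) and DEFINABLE ISOLATION IS FREE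
  (`stub_linearIndependentDefinable ∩ stub_locusDefinable`, projection to a coordinate: `coord_mem_expAcl`).

Off the log sector the same assembly proves the crux from the single open residue `stub_expImageFinite_offLog` (finitely
many exponential images of mates) — that composition is the line's skeleton `Cruxes/MinimalCounterexampleInAcl/Lines/
kernel-arithmetic-selection.lean`, which imports this file.
-/

noncomputable section

set_option linter.dupNamespace false

open Complex Set FirstOrder

namespace Summit.Schanuel.Schanuel.Cruxes.MinimalCounterexampleInAcl.KernelArithmeticSelection

open Literature.NumberTheory.Transcendental (SchanuelRank)
open Literature.ModelTheory.ExponentialFields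

variable {n : ℕ}

/-! ## Vocabulary -/

/-- The ℚ-locus of `(x, eˣ)` pulled back along `z ↦ (z, eᶻ)`: tuples `x'` such that `(x', e^{x'})` satisfies every
ℚ-polynomial relation of `(x, eˣ)` (i.e. `P_x ⊆ P_{x'}` for the prime ideals of relations in `ℚ[X₁…Xₙ, Y₁…Yₙ]`). -/
def locusPts (x : Fin n → ℂ) : Set (Fin n → ℂ) :=
  {x' | ∀ p : MvPolynomial (Fin n ⊕ Fin n) ℚ,
    MvPolynomial.aeval (Sum.elim x (cexp ∘ x)) p = 0 →
    MvPolynomial.aeval (Sum.elim x' (cexp ∘ x')) p = 0}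

/-- The MATES of `x`: ℚ-linearly independent points of the pulled-back ℚ-locus of `(x, eˣ)`. -/
def locusMates (x : Fin n → ℂ) : Set (Fin n → ℂ) :=
  {x' : Fin n → ℂ | LinearIndependent ℚ x'} ∩ locusPts x

/-- The first-failure counterexamples at rank `n` — the crux's hypothesis bundle (`x` ℚ-linearly independent,
`trdeg ℚ(x, eˣ) < n`, Schanuel in every rank `r < n`) as a SET of tuples (empty under Schanuel's conjecture). -/
def firstFailures (n : ℕ) : Set (Fin n → ℂ) :=
  {x | LinearIndependent ℚ x ∧
    Algebra.trdeg ℚ ↥(IntermediateField.adjoin ℚ (range x ∪ range (cexp ∘ x))) < (n : Cardinal) ∧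
    ∀ r < n, SchanuelRank r}

/-- The kernel translate `x + 2πi·k` of a tuple by an integer vector. -/
def kerTranslate (x : Fin n → ℂ) (k : Fin n → ℤ) : Fin n → ℂ :=
  fun i => x i + 2 * ↑Real.pi * I * (k i : ℂ)

/-! ## The landed stubs over the vocabulary (definitional agreement) -/

/-- Stub 1 over the vocabulary. -/
theorem linearIndependent_definable_voc (n : ℕ) :
    (∅ : Set ℂ).Definable Language.expRing {v : Fin n → ℂ | LinearIndependent ℚ v} :=
  stub_linearIndependentDefinable n

/-- Stub 2 over the vocabulary. -/
theorem locusPts_definable_voc (x : Fin n → ℂ) : (∅ : Set ℂ).Definable Language.expRing (locusPts x) :=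
  stub_locusDefinable n x

/-- Stub 3 over the vocabulary: a mate of a first failure is a first failure with the same locus. -/
theorem mate_firstFailure_voc {x x' : Fin n → ℂ} (hx : x ∈ firstFailures n) (hx' : x' ∈ locusMates x) :
    x' ∈ firstFailures n ∧ locusPts x' = locusPts x :=
  stub_mateFirstFailure n x x' hx hx'

/-- Schanuel in rank `1` is a theorem of the tree (Hermite–Lindemann `transcendental_exp_holds`). -/
theorem schanuelRank_one : SchanuelRank 1 :=
  Literature.Transcend.schanuelRank_one_of_transcendental_exp
    Literature.NumberTheory.Transcendental.transcendental_exp_holds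

/-- There are no first failures in ranks `0` and `1` (rank 1 by Hermite–Lindemann); the first open rank is `2`. -/
theorem two_le_of_mem_firstFailures {x : Fin n → ℂ} (hx : x ∈ firstFailures n) : 2 ≤ n := by
  rcases hx with ⟨hli, htr, -⟩
  by_contra hn
  interval_cases n
  · simp at htr
  · exact absurd htr (not_lt.2 (schanuelRank_one x hli))

/-- Kernel translates have the same exponentials. -/
theorem cexp_comp_kerTranslate (x : Fin n → ℂ) (k : Fin n → ℤ) : cexp ∘ kerTranslate x k = cexp ∘ x := by
  funext i
  simp only [Function.comp_apply, kerTranslate]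
  rw [Complex.exp_add, mul_comm (2 * ↑Real.pi * I) ((k i : ℂ)), Complex.exp_int_mul_two_pi_mul_I, mul_one]

/-- The hard case of the sweep delivers a line (stubs 4b-alg and 4b-core over the vocabulary). -/
theorem sweepLine_voc {x : Fin n → ℂ} (h3 : 3 ≤ n) (hx : x ∈ firstFailures n)
    (hinf : {k : Fin n → ℤ | kerTranslate x k ∈ locusMates x}.Infinite)
    (hB : IsAlgebraic ↥(IntermediateField.adjoin ℚ (Set.range x ∪ Set.range (Complex.exp ∘ x))) (2 * ↑Real.pi * Complex.I))
    (hnc : ∀ (k₀ v : Fin n → ℤ), v ≠ 0 → kerTranslate x k₀ ∈ locusMates x →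
      {t : ℤ | kerTranslate x (k₀ + t • v) ∈ locusPts x}.Finite) :
    ∃ (k₀ v : Fin n → ℤ), v ≠ 0 ∧ kerTranslate x k₀ ∈ locusMates x ∧
      ∀ s : ℂ, ∀ p : MvPolynomial (Fin n ⊕ Fin n) ℚ, MvPolynomial.aeval (Sum.elim x (cexp ∘ x)) p = 0 →
        MvPolynomial.aeval (Sum.elim (fun i => x i + 2 * ↑Real.pi * Complex.I * (k₀ i : ℂ) + s * (v i : ℂ))
          (cexp ∘ x)) p = 0 := by
  by_cases hY : IsAlgebraic ↥(IntermediateField.adjoin ℚ (Set.range (Complex.exp ∘ x))) (2 * ↑Real.pi * Complex.I)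
  · exact stub_sweepLine_algPeriod n h3 x hx hinf hY
  · exact stub_sweepLine_hardCore n h3 x hx hinf hB hY hnc

/-- The sweep (stub 4b-red over the vocabulary): a rational affine subspace through a mate-translate inside the fibre. -/
theorem sweepToSubspace_voc {x : Fin n → ℂ} (h3 : 3 ≤ n) (hx : x ∈ firstFailures n)
    (hinf : {k : Fin n → ℤ | kerTranslate x k ∈ locusMates x}.Infinite) :
    ∃ (m : ℕ) (q : Fin m → Fin n → ℚ) (k₀ : Fin n → ℤ), m < n ∧ LinearIndependent ℚ q ∧
      kerTranslate x k₀ ∈ locusMates x ∧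
      ∀ z : Fin n → ℂ, (∀ j, ∑ i, (q j i : ℂ) * z i = ∑ i, (q j i : ℂ) * kerTranslate x k₀ i) →
        ∀ p : MvPolynomial (Fin n ⊕ Fin n) ℚ, MvPolynomial.aeval (Sum.elim x (cexp ∘ x)) p = 0 →
          MvPolynomial.aeval (Sum.elim z (cexp ∘ x)) p = 0 :=
  stub_sweepToSubspace_of_line n h3 x hx hinf (sweepLine_voc h3 hx hinf)

/-- The endgame (stub 4c over the vocabulary). -/
theorem endgame_voc {x : Fin n → ℂ} (hx : x ∈ firstFailures n) {m : ℕ} (hm : m < n)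
    {q : Fin m → Fin n → ℚ} (hq : LinearIndependent ℚ q)
    (hN : ∀ z : Fin n → ℂ, (∀ j, ∑ i, (q j i : ℂ) * z i = ∑ i, (q j i : ℂ) * x i) →
      ∀ p : MvPolynomial (Fin n ⊕ Fin n) ℚ, MvPolynomial.aeval (Sum.elim x (cexp ∘ x)) p = 0 →
        MvPolynomial.aeval (Sum.elim z (cexp ∘ x)) p = 0) : False :=
  stub_endgame n x hx m hm q hq hN

/-- Branch finiteness in ranks `≥ 3`: an infinite kernel class of mates of `x` yields (sweep) a rational affine subspace
through a surviving mate-translate `x*` inside the fibre; `x*` is a first failure with the SAME locus (stub 3) and the SAME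
exponentials as `x`, so the endgame applies to it. -/
theorem branch_finite_higherRank {x : Fin n → ℂ} (h3 : 3 ≤ n) (hx : x ∈ firstFailures n) :
    {k : Fin n → ℤ | kerTranslate x k ∈ locusMates x}.Finite := by
  by_contra hinf
  obtain ⟨m, q, k₀, hm, hq, hk₀, hN⟩ := sweepToSubspace_voc h3 hx hinf
  obtain ⟨hff, hlocus⟩ := mate_firstFailure_voc hx hk₀
  have hxmem : x ∈ locusPts (kerTranslate x k₀) := by
    rw [hlocus]
    exact fun _ hp => hp
  refine endgame_voc hff hm hq ?_
  intro z hz p hp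
  rw [cexp_comp_kerTranslate]
  exact hN z hz p (hxmem p hp)

/-- Branch finiteness in every rank (ranks `0, 1` vacuous; rank `2` = stub 4a with its inductive hypothesis discharged;
ranks `≥ 3` = `branch_finite_higherRank`). -/
theorem branch_finite_voc {x : Fin n → ℂ} (hx : x ∈ firstFailures n) :
    {k : Fin n → ℤ | kerTranslate x k ∈ locusMates x}.Finite := by
  rcases Nat.lt_or_ge n 3 with h3 | h3
  · have h2 := two_le_of_mem_firstFailures hx
    obtain rfl : n = 2 := by omega
    exact stub_branchFiniteness_rankTwo x ⟨hx.1, by exact_mod_cast hx.2.1⟩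
  · exact branch_finite_higherRank h3 hx

/-- THE LOG SECTOR HAS FINITELY MANY CLASSES: if every `e^{x_i}` is algebraic, the exponentials of the mates of `x` are
coordinatewise roots of the minimal polynomials of the `e^{x_i}`. -/
theorem expImage_finite_of_algebraic {x : Fin n → ℂ} (halg : ∀ i, IsAlgebraic ℚ (cexp (x i))) :
    ((fun x' : Fin n → ℂ => cexp ∘ x') '' locusMates x).Finite := by
  classical
  have key : ∀ x' ∈ locusMates x, ∀ i, cexp (x' i) ∈ (minpoly ℚ (cexp (x i))).rootSet ℂ := by
    intro x' hx' i
    have hne : minpoly ℚ (cexp (x i)) ≠ 0 := minpoly.ne_zero (halg i).isIntegral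
    rw [Polynomial.mem_rootSet_of_ne hne]
    have h := hx'.2
      (Polynomial.aeval (MvPolynomial.X (Sum.inr i) : MvPolynomial (Fin n ⊕ Fin n) ℚ) (minpoly ℚ (cexp (x i)))) (by
        rw [← Polynomial.aeval_algHom_apply, MvPolynomial.aeval_X]
        simp [minpoly.aeval])
    rw [← Polynomial.aeval_algHom_apply, MvPolynomial.aeval_X] at h
    simpa using h
  refine (Set.Finite.pi' fun i : Fin n => Polynomial.rootSet_finite (minpoly ℚ (cexp (x i))) ℂ).subset ?_
  rintro _ ⟨x', hx', rfl⟩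
  exact fun i => key x' hx' i

/-! ## Finite mate set, definable isolation -/

/-- Every ℚ-linearly independent tuple is its own mate. -/
theorem self_mem_locusMates (x : Fin n → ℂ) (hx : LinearIndependent ℚ x) : x ∈ locusMates x :=
  ⟨hx, fun _ hp => hp⟩

/-- Two tuples with the same exponentials differ by a kernel translate. -/
theorem exists_kerTranslate_of_cexp_eq {x₀ x' : Fin n → ℂ} (h : cexp ∘ x' = cexp ∘ x₀) :
    ∃ k : Fin n → ℤ, x' = kerTranslate x₀ k := by
  have hk : ∀ i, ∃ m : ℤ, x' i = x₀ i + m * (2 * ↑Real.pi * I) := fun i =>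
    Complex.exp_eq_exp_iff_exists_int.1 (congr_fun h i)
  choose k hk using hk
  refine ⟨k, funext fun i => ?_⟩
  rw [hk i, kerTranslate]
  ring

/-- FINITENESS OF THE MATE SET of a first failure whose mates have finitely many exponential images: finitely many
kernel classes, each met finitely (branch finiteness at a representative, transported along the mate equivalence). -/
theorem locusMates_finite {x : Fin n → ℂ} (hx : x ∈ firstFailures n)
    (hExp : ((fun x' : Fin n → ℂ => cexp ∘ x') '' locusMates x).Finite) :
    (locusMates x).Finite := by
  refine Set.Finite.subset (hExp.biUnion
    (t := fun y => locusMates x ∩ (fun x' : Fin n → ℂ => cexp ∘ x') ⁻¹' {y}) ?_) ?_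
  · rintro y ⟨x₀, hx₀M, rfl⟩
    obtain ⟨hff₀, hlocus₀⟩ := mate_firstFailure_voc hx hx₀M
    have hMeq : locusMates x₀ = locusMates x := by
      unfold locusMates
      rw [hlocus₀]
    refine ((branch_finite_voc hff₀).image (kerTranslate x₀)).subset ?_
    rintro x' ⟨hx'M, hx'E⟩
    have hE : cexp ∘ x' = cexp ∘ x₀ := by
      simpa only [mem_preimage, mem_singleton_iff] using hx'E
    obtain ⟨k, rfl⟩ := exists_kerTranslate_of_cexp_eq hE
    refine ⟨k, ?_, rfl⟩
    show kerTranslate x₀ k ∈ locusMates x₀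
    rw [hMeq]
    exact hx'M
  · intro x' hx'
    exact Set.mem_iUnion₂.2 ⟨cexp ∘ x', ⟨x', hx', rfl⟩, hx', rfl⟩

/-- DEFINABILITY OF THE MATE SET ("definable isolation is free"): intersection of the two definable pieces. -/
theorem locusMates_definable (x : Fin n → ℂ) : (∅ : Set ℂ).Definable Language.expRing (locusMates x) :=
  (linearIndependent_definable_voc n).inter (locusPts_definable_voc x)

/-- Coordinates of a finite `∅`-definable set of tuples lie in finite `∅`-definable subsets of `ℂ`
(projection `Set.Definable.image_comp` along `Fin 1 → Fin n`). -/
theorem coord_mem_expAcl {M : Set (Fin n → ℂ)} (hfin : M.Finite)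
    (hdef : (∅ : Set ℂ).Definable Language.expRing M) {x : Fin n → ℂ} (hx : x ∈ M) (i : Fin n) :
    ∃ s : Set ℂ, s.Finite ∧ Set.Definable₁ (∅ : Set ℂ) Language.expRing s ∧ x i ∈ s := by
  refine ⟨(fun x' : Fin n → ℂ => x' i) '' M, hfin.image _, ?_, ⟨x, hx, rfl⟩⟩
  have himg := hdef.image_comp (fun _ : Fin 1 => i)
  unfold Set.Definable₁
  convert himg using 1
  ext v
  simp only [mem_setOf_eq, mem_image]
  constructor
  · rintro ⟨x', hx', hv⟩
    refine ⟨x', hx', funext fun j => ?_⟩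
    have hj : j = 0 := Subsingleton.elim j 0
    subst hj
    simpa using hv
  · rintro ⟨x', hx', rfl⟩
    exact ⟨x', hx', rfl⟩

/-- SPARSITY ⟹ acl: if the mate set of a first failure is finite, every coordinate lies in a finite `∅`-definable set. -/
theorem coord_mem_expAcl_of_sparsity {x : Fin n → ℂ} (hx : x ∈ firstFailures n) (hfin : (locusMates x).Finite)
    (i : Fin n) : ∃ s : Set ℂ, s.Finite ∧ Set.Definable₁ (∅ : Set ℂ) Language.expRing s ∧ x i ∈ s :=
  coord_mem_expAcl hfin (locusMates_definable x) (self_mem_locusMates x hx.1) i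

/-! ## The registered stub: (S*) on the log sector -/

/-- **(S*) ON THE LOG SECTOR (registered stub `stub_cruxLogSector`, PROVED).** A first-failure counterexample `x` to
Schanuel's conjecture at rank `n` (ℚ-linearly independent, `trdeg ℚ(x, eˣ) < n`, Schanuel in all ranks `< n`) ALL of
whose exponentials `e^{x_i}` are algebraic has every coordinate in `acl^{ℂ_exp}(∅)`: the mate set of `x` is finite
(finitely many classes by algebraicity, each class finite by branch finiteness in every rank) and `∅`-definable, and
contains `x`; project. Example of content: if `π` and `log 2` were algebraically dependent, `(log 2, πi)` would be a
rank-2 first failure and `log 2` would lie in a finite `∅`-definable subset of `(ℂ, +, ·, exp)`. -/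
theorem stub_cruxLogSector : ∀ (n : ℕ) (x : Fin n → ℂ), (LinearIndependent ℚ x ∧ Algebra.trdeg ℚ ↥(IntermediateField.adjoin ℚ (Set.range x ∪ Set.range (Complex.exp ∘ x))) < (n : Cardinal) ∧ ∀ r < n, Literature.NumberTheory.Transcendental.SchanuelRank r) → (∀ i, IsAlgebraic ℚ (Complex.exp (x i))) → ∀ i, ∃ s : Set ℂ, s.Finite ∧ Set.Definable₁ (∅ : Set ℂ) Literature.ModelTheory.ExponentialFields.Language.expRing s ∧ x i ∈ s := by
  intro n x hx halg i
  exact coord_mem_expAcl_of_sparsity hx (locusMates_finite hx (expImage_finite_of_algebraic halg)) i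

end Summit.Schanuel.Schanuel.Cruxes.MinimalCounterexampleInAcl.KernelArithmeticSelection

end
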